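import Literature.Probability.LatticeModels.KCTouchReach
import HarnessLib

/-!
# Plaquettes of points, free windows and box connectivity of the reachable set

Topic `Literature/Probability/LatticeModels`. Small lattice/continuum dictionary lemmas for the
assembly of the sign-condition argument (Chelkak–Smirnov 2012, proof of Thm. 6.1) from its
lattice inequality (`KCSignConditionLattice.lean`) and the reachable sets of `KCTouchReach.lean`:

* `plaqOf w` — the plaquette whose closed square contains the point `w` (lattice units), with
  `mem_plaqClosedSq_plaqOf`; `abs_sub_le_of_mem_plaqClosedSq`, `dist_plaqCentre_le_of_mem_plaqClosedSq`
  — a closed square containing `w` has its centre within `½` of `w` in each coordinate;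
* `corner_mem_of_box_free` — if all sites of a box of corners are free, every plaquette of the
  box has its four corners free (hence touches `Λ` across every side and is a touching plaquette);
* **`sqBox_subset_touchReach`** — a box of all-touching plaquettes off `avoid` containing one
  reachable plaquette is entirely reachable (walk along the axes; `add_cornerUnit_mem_touchReach`).

All `[folklore]`; no named fact.

## References

* D. Chelkak, S. Smirnov, Invent. Math. 189 (2012) = arXiv:0910.2045, proof of Thm. 6.1. [ChelkakSmirnov2012Ising]
-/

noncomputable section

open Set

namespace Literature.Probability.LatticeModels

open Site WeakBeurling

/-! ### The plaquette of a point -/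

/-- The plaquette (lower-left corner) whose closed unit square contains `w`. [folklore] -/
def plaqOf (w : ℂ) : Site 2 := ![⌊w.re⌋, ⌊w.im⌋]

/-- First coordinate of `plaqOf`. [folklore] -/
@[simp] theorem plaqOf_apply_zero (w : ℂ) : plaqOf w 0 = ⌊w.re⌋ := rfl

/-- Second coordinate of `plaqOf`. [folklore] -/
@[simp] theorem plaqOf_apply_one (w : ℂ) : plaqOf w 1 = ⌊w.im⌋ := rfl

/-- `w` lies in the closed square of `plaqOf w`. [folklore] -/
theorem mem_plaqClosedSq_plaqOf (w : ℂ) : w ∈ plaqClosedSq (plaqOf w) := by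
  simp only [plaqClosedSq, plaqOf_apply_zero, plaqOf_apply_one, Set.mem_setOf_eq]
  exact ⟨Int.floor_le _, (Int.lt_floor_add_one _).le, Int.floor_le _, (Int.lt_floor_add_one _).le⟩

/-- A closed square containing `w` has its centre within `½` of `w` in each coordinate. [folklore] -/
theorem abs_sub_le_of_mem_plaqClosedSq {f : Site 2} {w : ℂ} (h : w ∈ plaqClosedSq f) :
    |(plaqCentre f).re - w.re| ≤ 1 / 2 ∧ |(plaqCentre f).im - w.im| ≤ 1 / 2 := by
  obtain ⟨h1, h2, h3, h4⟩ := h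
  simp only [plaqCentre]
  constructor <;> (rw [abs_le]; constructor <;> linarith)

/-- A closed square containing `w` has its centre within distance `1` of `w`. [folklore] -/
theorem dist_plaqCentre_le_of_mem_plaqClosedSq {f : Site 2} {w : ℂ} (h : w ∈ plaqClosedSq f) :
    dist (plaqCentre f) w ≤ 1 := by
  obtain ⟨hr, hi⟩ := abs_sub_le_of_mem_plaqClosedSq h
  rw [dist_eq_norm]
  refine (Complex.norm_le_abs_re_add_abs_im _).trans ?_
  rw [Complex.sub_re, Complex.sub_im]
  linarith

/-- The corners of a plaquette are within distance `1` of its centre (in fact `√2/2`). [folklore] -/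
theorem dist_corner_plaqCentre_le (f : Site 2) (i : Fin 4) : dist (toComplex (f + cornerOff i)) (plaqCentre f) ≤ 1 := by
  rw [dist_eq_norm]
  refine (Complex.norm_le_abs_re_add_abs_im _).trans ?_
  simp only [Complex.sub_re, Complex.sub_im, toComplex_re, toComplex_im, plaqCentre, Pi.add_apply, Int.cast_add]
  have h : (cornerOff i 0 = 0 ∨ cornerOff i 0 = 1) ∧ (cornerOff i 1 = 0 ∨ cornerOff i 1 = 1) := by fin_cases i <;> simp
  have key : ∀ e₀ e₁ : ℤ, (e₀ = 0 ∨ e₀ = 1) → (e₁ = 0 ∨ e₁ = 1) →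
      |((f 0 : ℝ) + e₀ - ((f 0 : ℝ) + 1 / 2))| + |((f 1 : ℝ) + e₁ - ((f 1 : ℝ) + 1 / 2))| ≤ 1 := by
    intro e₀ e₁ he₀ he₁
    rcases he₀ with rfl | rfl <;> rcases he₁ with rfl | rfl <;> norm_num [abs_le]
  exact key _ _ h.1 h.2

/-! ### Free windows -/

/-- The corners of the plaquettes of `sqBox c R` are within sup-distance `R + 1` of `c`. [folklore] -/
theorem corner_sub_le_of_mem_sqBox {c f : Site 2} {R : ℤ} (hf : f ∈ sqBox c R) (i : Fin 4) :
    |(f + cornerOff i) 0 - c 0| ≤ R + 1 ∧ |(f + cornerOff i) 1 - c 1| ≤ R + 1 := by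
  rw [mem_sqBox, abs_le, abs_le] at hf
  have h : (cornerOff i 0 = 0 ∨ cornerOff i 0 = 1) ∧ (cornerOff i 1 = 0 ∨ cornerOff i 1 = 1) := by fin_cases i <;> simp
  simp only [Pi.add_apply]
  constructor
  · rcases h.1 with h0 | h0 <;> rw [h0, abs_le] <;> omega
  · rcases h.2 with h1 | h1 <;> rw [h1, abs_le] <;> omega

/-- **Free windows**: if every site within sup-distance `R + 1` of `c` is free, every plaquette of
`sqBox c R` has its four corners free. [folklore] -/
theorem corner_mem_of_box_free {Λ : Finset (Site 2)} {c : Site 2} {R : ℤ}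
    (hfree : ∀ v : Site 2, |v 0 - c 0| ≤ R + 1 → |v 1 - c 1| ≤ R + 1 → v ∈ Λ) {f : Site 2} (hf : f ∈ sqBox c R)
    (i : Fin 4) : f + cornerOff i ∈ Λ :=
  hfree _ (corner_sub_le_of_mem_sqBox hf i).1 (corner_sub_le_of_mem_sqBox hf i).2

/-- All four corners free: the plaquette touches `Λ` across every side. [folklore] -/
theorem sideTouch_of_box_free {Λ : Finset (Site 2)} {c : Site 2} {R : ℤ}
    (hfree : ∀ v : Site 2, |v 0 - c 0| ≤ R + 1 → |v 1 - c 1| ≤ R + 1 → v ∈ Λ) {f : Site 2} (hf : f ∈ sqBox c R)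
    (j : Fin 4) : SideTouch Λ f j := Or.inl (corner_mem_of_box_free hfree hf j)

/-- Sites within Euclidean distance are within sup-distance (for transferring ball hypotheses). [folklore] -/
theorem abs_sub_le_of_dist_toComplex_le {v c : Site 2} {r : ℝ} (h : dist (toComplex v) (toComplex c) ≤ r) :
    |((v 0 - c 0 : ℤ) : ℝ)| ≤ r ∧ |((v 1 - c 1 : ℤ) : ℝ)| ≤ r := by
  rw [dist_eq_norm] at h
  have hre := (Complex.abs_re_le_norm (toComplex v - toComplex c)).trans h
  have him := (Complex.abs_im_le_norm (toComplex v - toComplex c)).trans h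
  simp only [Complex.sub_re, Complex.sub_im, toComplex_re, toComplex_im] at hre him
  push_cast
  exact ⟨hre, him⟩

/-- Conversely, sup-distance controls Euclidean distance (by a factor `2 ≥ √2`). [folklore] -/
theorem dist_toComplex_le_of_abs_sub_le {v c : Site 2} {r : ℝ} (h0 : |((v 0 - c 0 : ℤ) : ℝ)| ≤ r) (h1 : |((v 1 - c 1 : ℤ) : ℝ)| ≤ r) :
    dist (toComplex v) (toComplex c) ≤ 2 * r := by
  rw [dist_eq_norm]
  refine (Complex.norm_le_abs_re_add_abs_im _).trans ?_
  simp only [Complex.sub_re, Complex.sub_im, toComplex_re, toComplex_im]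
  push_cast at h0 h1
  linarith

/-! ### Box connectivity of the reachable set -/

/-- Walking `n` unit steps inside a box of all-touching plaquettes off `avoid` stays reachable. [folklore] -/
theorem add_nsmul_cornerUnit_mem_touchReach {Λ : Finset (Site 2)} {avoid : Set (Site 2)} {f₀ : Site 2} (h₀ : f₀ ∉ avoid)
    {B : Set (Site 2)} (hall : ∀ f ∈ B, ∀ j : Fin 4, SideTouch Λ f j) (hav : ∀ f ∈ B, f ∉ avoid)
    {g : Site 2} (hg : g ∈ touchReach Λ avoid f₀) (m : Fin 4) (n : ℕ) (hB : ∀ i : ℕ, i ≤ n → g + i • cornerUnit m ∈ B) :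
    g + n • cornerUnit m ∈ touchReach Λ avoid f₀ := by
  induction n with
  | zero => simpa using hg
  | succ n ih =>
    have ih' := ih fun i hi => hB i (Nat.le_succ_of_le hi)
    rw [succ_nsmul, ← add_assoc]
    refine add_cornerUnit_mem_touchReach h₀ ih' m (hall _ (hB n (Nat.le_succ n))) (hav _ ?_)
    have := hB (n + 1) le_rfl
    rwa [succ_nsmul, ← add_assoc] at this

/-- Straight runs inside a box stay inside. [folklore] -/
theorem add_nsmul_cornerUnit_mem_sqBox {c g : Site 2} {R : ℤ} (hg : g ∈ sqBox c R) (m : Fin 4) {n : ℕ}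
    (hend : g + n • cornerUnit m ∈ sqBox c R) {i : ℕ} (hi : i ≤ n) : g + i • cornerUnit m ∈ sqBox c R := by
  rw [mem_sqBox, abs_le, abs_le] at hg hend ⊢
  simp only [Pi.add_apply, Pi.smul_apply] at hend ⊢
  have hi' : (i : ℤ) ≤ n := by exact_mod_cast hi
  fin_cases m <;> simp at hend ⊢ <;> omega

/-- **Box connectivity of the reachable set.** If every plaquette of `sqBox c R` touches `Λ`
across every side and is off `avoid`, and one plaquette of the box is reachable from `f₀`, then the
whole box is reachable. [folklore] -/
theorem sqBox_subset_touchReach {Λ : Finset (Site 2)} {avoid : Set (Site 2)} {f₀ c : Site 2} {R : ℤ} (h₀ : f₀ ∉ avoid)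
    (hall : ∀ f ∈ sqBox c R, ∀ j : Fin 4, SideTouch Λ f j) (hav : ∀ f ∈ sqBox c R, f ∉ avoid)
    {c' : Site 2} (hc' : c' ∈ sqBox c R) (hc'D : c' ∈ touchReach Λ avoid f₀) :
    ∀ f ∈ sqBox c R, f ∈ touchReach Λ avoid f₀ := by
  intro f hf
  -- the intermediate corner `g = (f 0, c' 1)`
  set g : Site 2 := ![f 0, c' 1] with hgdef
  have hg : g ∈ sqBox c R := by
    rw [mem_sqBox] at hc' hf ⊢
    simp only [hgdef, Matrix.cons_val_zero, Matrix.cons_val_one]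
    exact ⟨hf.1, hc'.2⟩
  -- first leg: `c' ⟶ g` along `x`
  have hgD : g ∈ touchReach Λ avoid f₀ := by
    by_cases hle : c' 0 ≤ f 0
    · have he : g = c' + (f 0 - c' 0).toNat • cornerUnit 0 := by
        have := Int.toNat_of_nonneg (sub_nonneg.2 hle)
        ext l; fin_cases l <;> simp [hgdef, Pi.add_apply]; omega
      rw [he]
      refine add_nsmul_cornerUnit_mem_touchReach h₀ hall hav hc'D 0 _ fun i hi => ?_
      exact add_nsmul_cornerUnit_mem_sqBox hc' 0 (he ▸ hg) hi
    · push Not at hle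
      have he : g = c' + (c' 0 - f 0).toNat • cornerUnit 2 := by
        have := Int.toNat_of_nonneg (sub_nonneg.2 hle.le)
        ext l; fin_cases l <;> simp [hgdef, Pi.add_apply]; omega
      rw [he]
      refine add_nsmul_cornerUnit_mem_touchReach h₀ hall hav hc'D 2 _ fun i hi => ?_
      exact add_nsmul_cornerUnit_mem_sqBox hc' 2 (he ▸ hg) hi
  -- second leg: `g ⟶ f` along `y`
  by_cases hle : c' 1 ≤ f 1
  · have he : f = g + (f 1 - c' 1).toNat • cornerUnit 1 := by
      have := Int.toNat_of_nonneg (sub_nonneg.2 hle)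
      ext l; fin_cases l <;> simp [hgdef, Pi.add_apply]; omega
    rw [he]
    refine add_nsmul_cornerUnit_mem_touchReach h₀ hall hav hgD 1 _ fun i hi => ?_
    exact add_nsmul_cornerUnit_mem_sqBox hg 1 (he ▸ hf) hi
  · push Not at hle
    have he : f = g + (c' 1 - f 1).toNat • cornerUnit 3 := by
      have := Int.toNat_of_nonneg (sub_nonneg.2 hle.le)
      ext l; fin_cases l <;> simp [hgdef, Pi.add_apply]; omega
    rw [he]
    refine add_nsmul_cornerUnit_mem_touchReach h₀ hall hav hgD 3 _ fun i hi => ?_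
    exact add_nsmul_cornerUnit_mem_sqBox hg 3 (he ▸ hf) hi

/-- Boxes inside boxes (for chaining windows). [folklore] -/
theorem sqBox_subset_sqBox_of_mem {c c' : Site 2} {r R : ℤ} (hc' : c' ∈ sqBox c (R - r)) :
    sqBox c' r ⊆ sqBox c R := by
  intro z hz
  rw [mem_sqBox, abs_le, abs_le] at hc' hz ⊢
  omega

end Literature.Probability.LatticeModels
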